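import Summits.HodgeConjecture.HodgeCM.Automorphic.AdelicTorusCompactInput_1

/-! PORT of `HodgeCM/Automorphic/AdelicTorusCompactInput.lean` (HodgeCMPerL run 82) — part 2: continuation of `Summits.HodgeConjecture.HodgeCM.Automorphic.AdelicTorusCompactInput_1` (split at a top-level declaration boundary by port_pkg.py; scope re-opened below; declarations unchanged). -/

-- port_pkg: scope re-opened for this part (file-level context, then the namespace/section stack open at the cut)
set_option autoImplicit false
noncomputable section
open NumberField TopologicalSpace MeasureTheory Set Filter Function
open scoped Topology CompactlySupported
attribute [-instance] Quotient.instMeasurableSpace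
namespace HodgeCM
namespace Universe
open HodgeCM.PerL34 HodgeCM.PerL34.Annihilation HodgeCM.PerL34.CompactTorusModel HodgeCM.Adelic
open HodgeCM.PerL34 HodgeCM.PerL34.Annihilation HodgeCM.Adelic
open HodgeCM.Prior.Perl34File HodgeCM.Prior.Perl34File.Perl34
variable (U : Universe)
/-- The adelic-level residual block of the (12) side of a context: on `U(W)(𝔸)` through `jT₁₂`. -/
abbrev ARest12 {L : CMField} (c : SeesawCtx L) : Type 1 := AdelicRest L c.D.gramW c.D.jT₁₂

/-- The adelic-level residual block of the (34) side of a context: on `U(W)(𝔸)` through `jT₃₄`. -/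
abbrev ARest34 {L : CMField} (c : SeesawCtx L) : Type 1 := AdelicRest L c.D.gramW c.D.jT₃₄

namespace AdelicTorusCore

variable {U} {hP : PrintFact_unitaryCompact} (C : U.AdelicTorusCore hP)

/-- The kernel-model core carrier of a context (the `K` over which the torus sides live). -/
abbrev kcore {L : CMField} {ι₁ : L →+* ℂ} (V : HermSpace3 L ι₁) (c : SeesawCtx L) :=
  KernelModel.core (V.latticeModel hP).toQuotientModel (c.D.latticeModelW hP).toQuotientModel (C.wm V c).SK
    (C.wm V c).omg (C.wm V c).θ

/-- The type of the (12) residual inputs of a context. -/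
abbrev Rest12 {L : CMField} {ι₁ : L →+* ℂ} (V : HermSpace3 L ι₁) (c : SeesawCtx L) : Type 1 :=
  CompactRest (C.kcore V c) (L : Type) (c.D.jT₁₂Model hP)

/-- The type of the (34) residual inputs of a context. -/
abbrev Rest34 {L : CMField} {ι₁ : L →+* ℂ} (V : HermSpace3 L ι₁) (c : SeesawCtx L) : Type 1 :=
  CompactRest (C.kcore V c) (L : Type) (c.D.jT₃₄Model hP)

/-- **The full torus theta data of #7 from the core and the residual inputs** (`tr12 := (R12 V c).rest`, …). -/
abbrev withRest
    (R12 : ∀ {L : CMField} {ι₁ : L →+* ℂ} (V : HermSpace3 L ι₁) (c : SeesawCtx L), C.Rest12 V c)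
    (R34 : ∀ {L : CMField} {ι₁ : L →+* ℂ} (V : HermSpace3 L ι₁) (c : SeesawCtx L), C.Rest34 V c) :
    U.AdelicTorusThetaData hP where
  emb := C.emb
  cover := C.cover
  kappa := C.kappa
  frameSign := C.frameSign
  wm := C.wm
  tr12 := fun V c => (R12 V c).rest
  tr34 := fun V c => (R34 V c).rest
  Theta := C.Theta

variable (R12 : ∀ {L : CMField} {ι₁ : L →+* ℂ} (V : HermSpace3 L ι₁) (c : SeesawCtx L), C.Rest12 V c)
  (R34 : ∀ {L : CMField} {ι₁ : L →+* ℂ} (V : HermSpace3 L ι₁) (c : SeesawCtx L), C.Rest34 V c)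

/-- The lattice-model theta data reached from the core and the residual inputs. -/
abbrev lmd : U.LatticeModelThetaData := (C.withRest R12 R34).toAdelicModelThetaData.toLatticeModelThetaData

/-- **The (12) reduced torus datum of a context, CONSTRUCTED** (pv15-g2's `CompactInput.toQuotientTorusDatum` on
`compactInput`, in the cocompact Haar model of `[U(W)]`). -/
def A12of {L : CMField} {ι₁ : L →+* ℂ} (V : HermSpace3 L ι₁) (c : SeesawCtx L) :
    QuotientTorusDatum ((C.lmd R12 R34).lat V c).toQuotientModel.ν
      ((C.lmd R12 R34).toWeilModelThetaData.toKernelModelThetaData.kcore V c).toRegCoreCarrier.toRepCoreCarrier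
      ((C.withRest R12 R34).toAdelicModelThetaData.kt12 V c).toRegTorusCarrier.toRepTorusCarrier :=
  ((R12 V c).compactInput (c.D.rat_le_comap_jT₁₂Model hP)).toQuotientTorusDatum
    ((C.lmd R12 R34).lat V c).toQuotientModel.isCocompactHaarModel

/-- **The (34) reduced torus datum of a context, CONSTRUCTED.** -/
def A34of {L : CMField} {ι₁ : L →+* ℂ} (V : HermSpace3 L ι₁) (c : SeesawCtx L) :
    QuotientTorusDatum ((C.lmd R12 R34).lat V c).toQuotientModel.ν
      ((C.lmd R12 R34).toWeilModelThetaData.toKernelModelThetaData.kcore V c).toRegCoreCarrier.toRepCoreCarrier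
      ((C.withRest R12 R34).toAdelicModelThetaData.kt34 V c).toRegTorusCarrier.toRepTorusCarrier :=
  ((R34 V c).compactInput (c.D.rat_le_comap_jT₃₄Model hP)).toQuotientTorusDatum
    ((C.lmd R12 R34).lat V c).toQuotientModel.isCocompactHaarModel

/-- `AnalyticKM` of the kernel model reached from the core and the residual inputs — NO torus datum hypothesis. -/
theorem analyticKM : (C.lmd R12 R34).toWeilModelThetaData.toKernelModelThetaData.AnalyticKM :=
  (C.lmd R12 R34).analyticKM_of_quotientData (fun V c => C.A12of R12 R34 V c) (fun V c => C.A34of R12 R34 V c)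

/-- The regularised theta carrier reached from the core and the residual inputs. -/
abbrev rtc : U.RegThetaCarrier :=
  (C.lmd R12 R34).toWeilModelThetaData.toKernelModelThetaData.toKernelThetaCarrier.toRegThetaCarrier

/-- `Rest12` from the adelic-level block (`jT₁₂Model = regimeLift jT₁₂` definitionally). -/
abbrev rest12OfAdelic (A12 : ∀ {L : CMField} (c : SeesawCtx L), ARest12 c)
    {L : CMField} {ι₁ : L →+* ℂ} (V : HermSpace3 L ι₁) (c : SeesawCtx L) : C.Rest12 V c :=
  (A12 c).toCompactRest (C.kcore V c)

/-- `Rest34` from the adelic-level block. -/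
abbrev rest34OfAdelic (A34 : ∀ {L : CMField} (c : SeesawCtx L), ARest34 c)
    {L : CMField} {ι₁ : L →+* ℂ} (V : HermSpace3 L ι₁) (c : SeesawCtx L) : C.Rest34 V c :=
  (A34 c).toCompactRest (C.kcore V c)

end AdelicTorusCore

end Universe

/-! ### END STATE -/

namespace Assembly

open HodgeCM.PerL34 HodgeCM.PerL34.Annihilation
open HodgeCM.Prior.Perl34File HodgeCM.Prior.Perl34File.Perl34
open HodgeCM.Universe (AdelicTorusCore AdelicTorusThetaData ThetaModel)

variable (U : Universe)

/-- **Both realisation inputs of part (a) — `RealisationExistsPerL ∧ RealisationExistsFace` — over the adelic unitary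
groups with PerL's tori and their COMPACT QUOTIENT MODELS.**  Hypotheses: the model facts `M`; the compactness criterion
`hP` [PRINT]; the core DATA `C`; per context and torus side the RESIDUAL `CompactRest` (character bookkeeping + `emb`
identifications + finite-adelic block with `dense`); the ten theta `Inputs`; Hodge–Riemann.  Versus
`realisationExists_ofAdelicTorusData`: NO `QuotientTorusDatum` (`unfold`, `fourier`, `PT_cov`, `res_spec`, `res_transl`,
smoothing) — theorems of pv15-g2's kernel model over `[T] = T(𝔸) ⧸ T(L₀)` for the genuine tori. -/
theorem realisationExists_ofAdelicTorusCompactRest (M : U.ModelAxioms) (hP : PrintFact_unitaryCompact)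
    (C : U.AdelicTorusCore hP)
    (R12 : ∀ {L : CMField} {ι₁ : L →+* ℂ} (V : HermSpace3 L ι₁) (c : SeesawCtx L), C.Rest12 V c)
    (R34 : ∀ {L : CMField} {ι₁ : L →+* ℂ} (V : HermSpace3 L ι₁) (c : SeesawCtx L), C.Rest34 V c)
    (A : (ThetaModel.ofRegCarrier (C.rtc R12 R34) (C.analyticKM R12 R34).toAnalytic).Inputs)
    (hHR : U.Fact_hodgeRiemann20) : U.RealisationExistsPerL ∧ U.RealisationExistsFace :=
  realisationExists_ofAdelicTorusData U M hP (C.withRest R12 R34) (fun V c => C.A12of R12 R34 V c)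
    (fun V c => C.A34of R12 R34 V c) A hHR

/-- **PerL over the adelic unitary groups with PerL's tori and their compact quotient models.** -/
theorem perL_ofAdelicTorusCompactRest (M : U.ModelAxioms) (hP : PrintFact_unitaryCompact)
    (C : U.AdelicTorusCore hP)
    (R12 : ∀ {L : CMField} {ι₁ : L →+* ℂ} (V : HermSpace3 L ι₁) (c : SeesawCtx L), C.Rest12 V c)
    (R34 : ∀ {L : CMField} {ι₁ : L →+* ℂ} (V : HermSpace3 L ι₁) (c : SeesawCtx L), C.Rest34 V c)
    (A : (ThetaModel.ofRegCarrier (C.rtc R12 R34) (C.analyticKM R12 R34).toAnalytic).Inputs)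
    (hHR : U.Fact_hodgeRiemann20) : U.PerL :=
  perL_ofAdelicTorusData U M hP (C.withRest R12 R34) (fun V c => C.A12of R12 R34 V c)
    (fun V c => C.A34of R12 R34 V c) A hHR

/-- **COR-CM, END STATE over the adelic unitary groups with PerL's tori and their compact quotient models.** -/
theorem COR_CM_endState_ofAdelicTorusCompactRest (M : U.ModelAxioms) (h29 : U.Fact_weightSpan)
    (h30 : U.Fact_weightHodge) (hE : U.Qw8ExtProd) (hD : U.Qw8DualPushPull) (hMi : U.Qw8Milne)
    (hP : PrintFact_unitaryCompact) (C : U.AdelicTorusCore hP)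
    (R12 : ∀ {L : CMField} {ι₁ : L →+* ℂ} (V : HermSpace3 L ι₁) (c : SeesawCtx L), C.Rest12 V c)
    (R34 : ∀ {L : CMField} {ι₁ : L →+* ℂ} (V : HermSpace3 L ι₁) (c : SeesawCtx L), C.Rest34 V c)
    (A : (ThetaModel.ofRegCarrier (C.rtc R12 R34) (C.analyticKM R12 R34).toAnalytic).Inputs)
    (hHR : U.Fact_hodgeRiemann20) : U.HC_CM :=
  COR_CM_endState_ofAdelicTorusData U M h29 h30 hE hD hMi hP (C.withRest R12 R34) (fun V c => C.A12of R12 R34 V c)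
    (fun V c => C.A34of R12 R34 V c) A hHR

/-- **Both realisation inputs of part (a), the residual block stated on the GENUINE adelic unitary groups** `U(W)(𝔸_L)`
(per context: `ARest12 c` through `jT₁₂`, `ARest34 c` through `jT₃₄` — characters + `emb` identifications + `Gf, ψ,
comm, dense`), transported to the regime models by §12b.  This is the form pv11-g5's `SeesawChars` and pv06-g4's
`AdelicUnitaryFactorisation` plug into. -/
theorem realisationExists_ofAdelicRest (M : U.ModelAxioms) (hP : PrintFact_unitaryCompact)
    (C : U.AdelicTorusCore hP)
    (A12 : ∀ {L : CMField} (c : SeesawCtx L), Universe.ARest12 c)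
    (A34 : ∀ {L : CMField} (c : SeesawCtx L), Universe.ARest34 c)
    (A : (ThetaModel.ofRegCarrier (C.rtc (fun V c => C.rest12OfAdelic A12 V c) (fun V c => C.rest34OfAdelic A34 V c))
      (C.analyticKM (fun V c => C.rest12OfAdelic A12 V c) (fun V c => C.rest34OfAdelic A34 V c)).toAnalytic).Inputs)
    (hHR : U.Fact_hodgeRiemann20) : U.RealisationExistsPerL ∧ U.RealisationExistsFace :=
  realisationExists_ofAdelicTorusCompactRest U M hP C (fun V c => C.rest12OfAdelic A12 V c)
    (fun V c => C.rest34OfAdelic A34 V c) A hHR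

/-- **PerL, residual block on the genuine adelic unitary groups.** -/
theorem perL_ofAdelicRest (M : U.ModelAxioms) (hP : PrintFact_unitaryCompact) (C : U.AdelicTorusCore hP)
    (A12 : ∀ {L : CMField} (c : SeesawCtx L), Universe.ARest12 c)
    (A34 : ∀ {L : CMField} (c : SeesawCtx L), Universe.ARest34 c)
    (A : (ThetaModel.ofRegCarrier (C.rtc (fun V c => C.rest12OfAdelic A12 V c) (fun V c => C.rest34OfAdelic A34 V c))
      (C.analyticKM (fun V c => C.rest12OfAdelic A12 V c) (fun V c => C.rest34OfAdelic A34 V c)).toAnalytic).Inputs)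
    (hHR : U.Fact_hodgeRiemann20) : U.PerL :=
  perL_ofAdelicTorusCompactRest U M hP C (fun V c => C.rest12OfAdelic A12 V c)
    (fun V c => C.rest34OfAdelic A34 V c) A hHR

/-- **COR-CM, END STATE with the residual block on the genuine adelic unitary groups.** -/
theorem COR_CM_endState_ofAdelicRest (M : U.ModelAxioms) (h29 : U.Fact_weightSpan)
    (h30 : U.Fact_weightHodge) (hE : U.Qw8ExtProd) (hD : U.Qw8DualPushPull) (hMi : U.Qw8Milne)
    (hP : PrintFact_unitaryCompact) (C : U.AdelicTorusCore hP)
    (A12 : ∀ {L : CMField} (c : SeesawCtx L), Universe.ARest12 c)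
    (A34 : ∀ {L : CMField} (c : SeesawCtx L), Universe.ARest34 c)
    (A : (ThetaModel.ofRegCarrier (C.rtc (fun V c => C.rest12OfAdelic A12 V c) (fun V c => C.rest34OfAdelic A34 V c))
      (C.analyticKM (fun V c => C.rest12OfAdelic A12 V c) (fun V c => C.rest34OfAdelic A34 V c)).toAnalytic).Inputs)
    (hHR : U.Fact_hodgeRiemann20) : U.HC_CM :=
  COR_CM_endState_ofAdelicTorusCompactRest U M h29 h30 hE hD hMi hP C (fun V c => C.rest12OfAdelic A12 V c)
    (fun V c => C.rest34OfAdelic A34 V c) A hHR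

end Assembly

end HodgeCM

end
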